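import Literature.Algebra.EuclideanLattices.GadgetTrapdoor
import Mathlib.LinearAlgebra.Matrix.ToLin
import HarnessLib

/-!
# The gadget basis generates `Λ^⊥(G)`, and `S_A` generates `Λ^⊥(A)` (MP12 Thm. 4.1, Lemma 5.3)

Topic `Algebra/EuclideanLattices`, sequel of `GadgetTrapdoor.lean` (gadget `G = Iₙ ⊗ (1, 2, …, 2^{k-1})`
over `ℤ_{2ᵏ}`, its basis vectors `gadgetBasis n k p` = columns of `GadgetTrapdoor.gadgetS n k`, the
`G`-trapdoor notion, the block matrix `S_A = trapdoorBasisMatrix R W S` of MP12 Lemma 5.3 and the MP12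
trapdoor `GadgetTrapdoor` with `perpBasis`; there: every basis vector LIES in the lattice). This file
proves the GENERATION halves and linear independence, all over `ℤ` (no analysis):

* `sum_gadgetBasisVec_mul` — the action of the bidiagonal `S_k` on coefficients over any ring:
  `∑ₜ (S_k)_{u,t} cₜ = 2c_u − c_{u−1}`;
* `gadgetCoeff`/`gadgetCoeffs` — explicit integer coordinates of a vector of `Λ^⊥(G)` in the gadget
  basis (`c_t = (∑_{j≤t} 2ʲ xⱼ)/2^{t+1}`, an exact division), `gadgetS_mulVec_gadgetCoeffs`, and
  **`span_gadgetBasis_eq`**: `span_ℤ {gadgetBasis} = Λ^⊥(G)` (MP12 Thm. 4.1 / §4.1: `S = Iₙ ⊗ S_k`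
  is a basis of `Λ^⊥(G)` for `q = 2ᵏ`);
* **`perpLattice_le_span_trapdoorBasisCol`** (MP12 Lemma 5.3, generation half, tag `I`): if
  `A [R; I] = G`, `G W ≡ −A₁` and the columns of `S` generate `Λ^⊥(G)`, then the columns of `S_A`
  generate `Λ^⊥(A)` — by the printed argument through `T⁻¹x = (x₁ − Rx₂, x₂)` and `[A₁ | G]`;
  `GadgetTrapdoor.span_perpBasis_eq`: **`span_ℤ {perpBasis T} = Λ^⊥(T.pub)`**;
* `gadgetS_map_mulVec_injective`, `trapdoorBasisMatrix_map_mulVec_injective`,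
  `GadgetTrapdoor.perpBasisMatrix_map_mulVec_injective`, `GadgetTrapdoor.linearIndependent_perpBasis_cast` —
  over any commutative ring of characteristic zero without zero divisors (e.g. `ℤ`, `ℚ`, `ℝ`) the
  columns of `S_A` are linearly independent (so `S_A` is a basis, `m = m̄ + nk` vectors).

## References

* D. Micciancio, C. Peikert, *Trapdoors for lattices: simpler, tighter, faster, smaller*,
  EUROCRYPT 2012 (ePrint 2011/501), §4.1 (Prop. 4.2: `S_k` is a basis of `Λ^⊥(gᵗ)`, `det S_k = 2ᵏ`),
  Thm. 4.1, Lemma 5.3. [MicciancioPeikert2012]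
-/

namespace Literature.Algebra.EuclideanLattices

open Matrix Finset

/-! ### The bidiagonal gadget basis `S_k` acting on coefficients -/

section GadgetGen

variable {k : ℕ}

/-- **The action of `S_k` on a coefficient vector** (any coefficient ring): with `(S_k)_{u,t}` the
`u`-th entry of the column `2eₜ − eₜ₊₁`, `∑ₜ (S_k)_{u,t} cₜ = 2 c_u − c_{u−1}` (and `2 c₀` for `u = 0`).
[cite: MicciancioPeikert2012, §4.1 (the matrix S_k)] -/
theorem sum_gadgetBasisVec_mul {L : Type*} [CommRing L] (c : Fin k → L) (u : Fin k) :
    ∑ t : Fin k, (gadgetBasisVec k t u : L) * c t =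
      2 * c u - if h : 0 < (u : ℕ) then c ⟨(u : ℕ) - 1, by omega⟩ else 0 := by
  classical
  have hsplit : ∀ t : Fin k, (gadgetBasisVec k t u : L) * c t =
      (if t = u then 2 * c t else 0) - (if (u : ℕ) = (t : ℕ) + 1 then c t else 0) := by
    intro t
    unfold gadgetBasisVec
    by_cases h1 : u = t
    · subst h1
      simp
    · have h1' : ¬ (t = u) := fun h => h1 h.symm
      by_cases h2 : (u : ℕ) = (t : ℕ) + 1
      · simp [h1, h1', h2]
      · simp [h1, h1', h2]
  simp_rw [hsplit]
  rw [Finset.sum_sub_distrib, Finset.sum_ite_eq' Finset.univ u, if_pos (Finset.mem_univ _)]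
  congr 1
  by_cases hu : 0 < (u : ℕ)
  · rw [dif_pos hu, Finset.sum_eq_single ⟨(u : ℕ) - 1, by omega⟩]
    · rw [if_pos]
      simp only
      omega
    · intro t _ ht
      rw [if_neg]
      intro h
      exact ht (Fin.ext (by simp only; omega))
    · intro h; exact absurd (Finset.mem_univ _) h
  · rw [dif_neg hu]
    refine Finset.sum_eq_zero fun t _ => ?_
    rw [if_neg]
    omega

/-- **`S_k` is injective on coefficients** over a ring where `2` is not a zero divisor: if
`2c_u − c_{u−1} = 0` for all `u` then `c = 0` (forward substitution). [cite: MicciancioPeikert2012, §4.1 (det S_k = 2^k ≠ 0)] -/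
theorem eq_zero_of_sum_gadgetBasisVec_mul_eq_zero {L : Type*} [CommRing L] [NoZeroDivisors L] [CharZero L]
    {c : Fin k → L} (h : ∀ u : Fin k, ∑ t : Fin k, (gadgetBasisVec k t u : L) * c t = 0) : c = 0 := by
  have key : ∀ m : ℕ, ∀ u : Fin k, (u : ℕ) = m → c u = 0 := by
    intro m
    induction m with
    | zero =>
      intro u hu
      have hu' := h u
      rw [sum_gadgetBasisVec_mul, dif_neg (by omega), sub_zero] at hu'
      exact (mul_eq_zero.1 hu').resolve_left two_ne_zero
    | succ m ih =>
      intro u hu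
      have hu' := h u
      rw [sum_gadgetBasisVec_mul, dif_pos (by omega), ih ⟨(u : ℕ) - 1, by omega⟩ (by simp only; omega),
        sub_zero] at hu'
      exact (mul_eq_zero.1 hu').resolve_left two_ne_zero
  funext u
  exact key u u rfl

/-! ### Explicit coordinates in the gadget basis (prefix sums) -/

/-- The weighted prefix sums `P_t(x) = ∑_{j ≤ t} 2ʲ xⱼ` of a block `x ∈ ℤᵏ`. [folklore] -/
def gadgetPrefix (x : Fin k → ℤ) (t : ℕ) : ℤ :=
  ∑ j ∈ Finset.univ.filter (fun j : Fin k => (j : ℕ) ≤ t), 2 ^ (j : ℕ) * x j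

/-- `P_0 = x₀`. [folklore] -/
theorem gadgetPrefix_zero (x : Fin k → ℤ) (hk : 0 < k) : gadgetPrefix x 0 = x ⟨0, hk⟩ := by
  rw [gadgetPrefix, Finset.sum_filter, Finset.sum_eq_single ⟨0, hk⟩]
  · simp
  · intro j _ hj
    rw [if_neg]
    intro h
    exact hj (Fin.ext (by simp only; omega))
  · intro h; exact absurd (Finset.mem_univ _) h

/-- `P_{t+1} = P_t + 2^{t+1} x_{t+1}`. [folklore] -/
theorem gadgetPrefix_succ (x : Fin k → ℤ) {t : ℕ} (ht : t + 1 < k) :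
    gadgetPrefix x (t + 1) = gadgetPrefix x t + 2 ^ (t + 1) * x ⟨t + 1, ht⟩ := by
  rw [gadgetPrefix, gadgetPrefix, Finset.sum_filter, Finset.sum_filter,
    show (2 : ℤ) ^ (t + 1) * x ⟨t + 1, ht⟩ = ∑ j : Fin k, if j = ⟨t + 1, ht⟩ then 2 ^ (j : ℕ) * x j else 0 by
      rw [Finset.sum_ite_eq']; simp,
    ← Finset.sum_add_distrib]
  refine Finset.sum_congr rfl fun j _ => ?_
  by_cases h : (j : ℕ) ≤ t
  · have h' : (j : ℕ) ≤ t + 1 := by omega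
    have h'' : j ≠ ⟨t + 1, ht⟩ := fun e => by rw [e] at h; simp only at h; omega
    simp [h, h', h'']
  · by_cases h2 : (j : ℕ) = t + 1
    · have hj : j = ⟨t + 1, ht⟩ := Fin.ext h2
      subst hj
      simp
    · have h3 : ¬ ((j : ℕ) ≤ t + 1) := by omega
      have h4 : j ≠ ⟨t + 1, ht⟩ := fun e => h2 (by rw [e])
      simp [h, h3, h4]

/-- Past the last index the prefix sum is the full weighted sum. [folklore] -/
theorem gadgetPrefix_of_le (x : Fin k → ℤ) {t : ℕ} (ht : k ≤ t + 1) :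
    gadgetPrefix x t = ∑ j : Fin k, 2 ^ (j : ℕ) * x j := by
  rw [gadgetPrefix, Finset.filter_true_of_mem]
  intro j _
  have := j.isLt
  omega

/-- **Divisibility of the prefix sums**: if `2ᵏ ∣ ∑ⱼ 2ʲ xⱼ` (i.e. `x ∈ Λ^⊥(gᵗ)`) then `2^{t+1} ∣ P_t`
for every `t < k` (the tail `∑_{j > t} 2ʲ xⱼ` is divisible by `2^{t+1}`, and so is `2ᵏ`). [cite: MicciancioPeikert2012, §4.1] -/
theorem dvd_gadgetPrefix {x : Fin k → ℤ} (hx : (2 ^ k : ℤ) ∣ ∑ j : Fin k, 2 ^ (j : ℕ) * x j) {t : ℕ} (ht : t < k) :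
    (2 : ℤ) ^ (t + 1) ∣ gadgetPrefix x t := by
  have hsplit := Finset.sum_filter_add_sum_filter_not Finset.univ (fun j : Fin k => (j : ℕ) ≤ t)
    (fun j : Fin k => (2 : ℤ) ^ (j : ℕ) * x j)
  have htail : (2 : ℤ) ^ (t + 1) ∣ ∑ j ∈ Finset.univ.filter (fun j : Fin k => ¬ ((j : ℕ) ≤ t)), 2 ^ (j : ℕ) * x j := by
    refine Finset.dvd_sum fun j hj => ?_
    have hj' : t + 1 ≤ (j : ℕ) := by have := (Finset.mem_filter.1 hj).2; omega
    exact Dvd.dvd.mul_right (pow_dvd_pow 2 hj') _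
  have hfull : (2 : ℤ) ^ (t + 1) ∣ ∑ j : Fin k, 2 ^ (j : ℕ) * x j :=
    (pow_dvd_pow 2 (by omega : t + 1 ≤ k)).trans hx
  have heq : gadgetPrefix x t = (∑ j : Fin k, 2 ^ (j : ℕ) * x j) -
      ∑ j ∈ Finset.univ.filter (fun j : Fin k => ¬ ((j : ℕ) ≤ t)), 2 ^ (j : ℕ) * x j := by
    rw [gadgetPrefix, ← hsplit, add_sub_cancel_right]
  rw [heq]
  exact dvd_sub hfull htail

/-- **The coordinate `c_t = P_t / 2^{t+1}`** of a vector of `Λ^⊥(gᵗ)` in the basis `S_k` (an exact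
division by `dvd_gadgetPrefix`; MP12 §4.1: solving the bidiagonal system). [cite: MicciancioPeikert2012, §4.1] -/
def gadgetCoeff (x : Fin k → ℤ) (t : Fin k) : ℤ := gadgetPrefix x t / 2 ^ ((t : ℕ) + 1)

/-- `2^{t+1} c_t = P_t`. [cite: MicciancioPeikert2012, §4.1] -/
theorem two_pow_mul_gadgetCoeff {x : Fin k → ℤ} (hx : (2 ^ k : ℤ) ∣ ∑ j : Fin k, 2 ^ (j : ℕ) * x j) (t : Fin k) :
    2 ^ ((t : ℕ) + 1) * gadgetCoeff x t = gadgetPrefix x t :=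
  Int.mul_ediv_cancel' (dvd_gadgetPrefix hx t.isLt)

/-- **`S_k c = x`**: the coordinates recombine, `2 c_u − c_{u−1} = x_u`. [cite: MicciancioPeikert2012, §4.1 (S_k is a basis of Λ^⊥(g^t))] -/
theorem sum_gadgetBasisVec_mul_gadgetCoeff {x : Fin k → ℤ} (hx : (2 ^ k : ℤ) ∣ ∑ j : Fin k, 2 ^ (j : ℕ) * x j)
    (u : Fin k) : ∑ t : Fin k, gadgetBasisVec k t u * gadgetCoeff x t = x u := by
  have h := sum_gadgetBasisVec_mul (L := ℤ) (gadgetCoeff x) u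
  simp only [Int.cast_id] at h
  rw [h]
  have hu1 := two_pow_mul_gadgetCoeff hx u
  by_cases hu : 0 < (u : ℕ)
  · rw [dif_pos hu]
    obtain ⟨t, ht⟩ : ∃ t : ℕ, (u : ℕ) = t + 1 := ⟨(u : ℕ) - 1, by omega⟩
    have htk : t + 1 < k := ht ▸ u.isLt
    have hut : u = ⟨t + 1, htk⟩ := Fin.ext ht
    subst hut
    have ht1 := two_pow_mul_gadgetCoeff hx ⟨t, by omega⟩
    simp only at hu1 ht1 ⊢
    have hsucc := gadgetPrefix_succ x htk
    -- `2^{t+1} (2 c_{t+1} − c_t) = P_{t+1} − P_t = 2^{t+1} x_{t+1}`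
    have hne : (2 : ℤ) ^ (t + 1) ≠ 0 := pow_ne_zero _ two_ne_zero
    refine mul_left_cancel₀ hne ?_
    have e1 : (2 : ℤ) ^ (t + 1) * (2 * gadgetCoeff x ⟨t + 1, htk⟩ - gadgetCoeff x ⟨t + 1 - 1, by omega⟩) =
        2 ^ (t + 1 + 1) * gadgetCoeff x ⟨t + 1, htk⟩ - 2 ^ (t + 1) * gadgetCoeff x ⟨t, by omega⟩ := by
      have : (⟨t + 1 - 1, by omega⟩ : Fin k) = ⟨t, by omega⟩ := Fin.ext (by simp)
      rw [this]; ring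
    rw [e1, hu1, ht1, hsucc]
    ring
  · rw [dif_neg hu, sub_zero]
    have hu0 : (u : ℕ) = 0 := by omega
    have hk : 0 < k := by have := u.isLt; omega
    have hu' : u = ⟨0, hk⟩ := Fin.ext hu0
    subst hu'
    simp only at hu1
    rw [pow_one] at hu1
    rw [hu1, gadgetPrefix_zero]

end GadgetGen

/-! ### `S = Iₙ ⊗ S_k` generates `Λ^⊥(G)` -/

section GadgetBlocks

variable {n k : ℕ}

/-- The block coordinates of `x ∈ Λ^⊥(G)` in the gadget basis: block `i` uses `gadgetCoeff` of the
`i`-th block of `x`. [cite: MicciancioPeikert2012, §4 (direct sum of n copies)] -/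
def gadgetCoeffs (x : Fin n × Fin k → ℤ) : Fin n × Fin k → ℤ := fun p => gadgetCoeff (fun t => x (p.1, t)) p.2

/-- The action of `S = Iₙ ⊗ S_k` (any coefficient ring): block `i` of `S c` is `S_k` applied to block `i`
of `c`. [cite: MicciancioPeikert2012, §4 (S = I_n ⊗ S_k)] -/
theorem gadgetS_map_mulVec_apply {L : Type*} [CommRing L] (c : Fin n × Fin k → L) (i : Fin n) (u : Fin k) :
    ((GadgetTrapdoor.gadgetS n k).map (Int.cast : ℤ → L) *ᵥ c) (i, u) =
      ∑ t : Fin k, (gadgetBasisVec k t u : L) * c (i, t) := by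
  classical
  rw [mulVec, dotProduct, Fintype.sum_prod_type, Finset.sum_eq_single i]
  · refine Finset.sum_congr rfl fun t _ => ?_
    simp [GadgetTrapdoor.gadgetS, gadgetBasis]
  · intro i' _ hi'
    refine Finset.sum_eq_zero fun t _ => ?_
    simp [GadgetTrapdoor.gadgetS, gadgetBasis, Ne.symm hi']
  · intro h; exact absurd (Finset.mem_univ _) h

/-- The same over `ℤ` (no cast). [cite: MicciancioPeikert2012, §4] -/
theorem gadgetS_mulVec_apply (c : Fin n × Fin k → ℤ) (i : Fin n) (u : Fin k) :
    (GadgetTrapdoor.gadgetS n k *ᵥ c) (i, u) = ∑ t : Fin k, gadgetBasisVec k t u * c (i, t) := by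
  have h := gadgetS_map_mulVec_apply (L := ℤ) c i u
  simp only [Int.cast_id] at h
  have hmap : (GadgetTrapdoor.gadgetS n k).map (Int.cast : ℤ → ℤ) = GadgetTrapdoor.gadgetS n k := by
    ext; simp
  rw [← h, hmap]

/-- Membership in `Λ^⊥(G)` blockwise: `2ᵏ ∣ ∑ₜ 2ᵗ x_{(i,t)}` for every block `i`. [cite: MicciancioPeikert2012, §4] -/
theorem dvd_sum_of_mem_perpLattice_gadgetMatrix {x : Fin n × Fin k → ℤ} (hx : x ∈ perpLattice (gadgetMatrix n k))
    (i : Fin n) : (2 ^ k : ℤ) ∣ ∑ t : Fin k, 2 ^ (t : ℕ) * x (i, t) := by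
  have h := congrFun (mem_perpLattice.1 hx) i
  rw [gadgetMatrix_mulVec, Pi.zero_apply] at h
  have hcast : ((∑ t : Fin k, 2 ^ (t : ℕ) * x (i, t) : ℤ) : ZMod (2 ^ k)) = 0 := by
    rw [← h]; push_cast; simp [modQ]
  have := (ZMod.intCast_zmod_eq_zero_iff_dvd _ _).1 hcast
  push_cast at this
  exact this

/-- **`S · coeffs(x) = x` for `x ∈ Λ^⊥(G)`.** [cite: MicciancioPeikert2012, Thm. 4.1 (S is a basis of Λ^⊥(G))] -/
theorem gadgetS_mulVec_gadgetCoeffs {x : Fin n × Fin k → ℤ} (hx : x ∈ perpLattice (gadgetMatrix n k)) :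
    GadgetTrapdoor.gadgetS n k *ᵥ gadgetCoeffs x = x := by
  funext ⟨i, u⟩
  rw [gadgetS_mulVec_apply]
  exact sum_gadgetBasisVec_mul_gadgetCoeff (dvd_sum_of_mem_perpLattice_gadgetMatrix hx i) u

/-- The columns of `gadgetS` are the gadget basis vectors. [cite: MicciancioPeikert2012, §4] -/
theorem col_gadgetS : (GadgetTrapdoor.gadgetS n k).col = gadgetBasis n k := rfl

/-- **MP12 Thm. 4.1 / Prop. 4.2 (`q = 2ᵏ`): the gadget basis generates `Λ^⊥(G)`**,
`span_ℤ {gadgetBasis n k p} = Λ^⊥(G)`. [cite: MicciancioPeikert2012, Thm. 4.1] -/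
theorem span_gadgetBasis_eq :
    Submodule.span ℤ (Set.range (gadgetBasis n k)) = perpLattice (gadgetMatrix n k) := by
  refine le_antisymm (Submodule.span_le.2 ?_) fun x hx => ?_
  · rintro _ ⟨p, rfl⟩
    exact gadgetBasis_mem_perpLattice p
  · rw [← col_gadgetS, ← Matrix.range_mulVecLin]
    exact ⟨gadgetCoeffs x, gadgetS_mulVec_gadgetCoeffs hx⟩

/-- **`S` is injective on coefficients** over any commutative ring of characteristic zero without zero
divisors (blockwise forward substitution). [cite: MicciancioPeikert2012, §4.1 (det S_k = q ≠ 0)] -/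
theorem gadgetS_map_mulVec_injective {L : Type*} [CommRing L] [NoZeroDivisors L] [CharZero L] :
    Function.Injective fun c : Fin n × Fin k → L => (GadgetTrapdoor.gadgetS n k).map (Int.cast : ℤ → L) *ᵥ c := by
  intro c c' h
  rw [← sub_eq_zero]
  have h0 : (GadgetTrapdoor.gadgetS n k).map (Int.cast : ℤ → L) *ᵥ (c - c') = 0 := by
    rw [mulVec_sub, sub_eq_zero]; exact h
  funext ⟨i, u⟩
  have hblock : (fun t => (c - c') (i, t)) = 0 := by
    refine eq_zero_of_sum_gadgetBasisVec_mul_eq_zero fun u' => ?_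
    rw [← gadgetS_map_mulVec_apply, h0, Pi.zero_apply]
  exact congrFun hblock u

end GadgetBlocks

/-! ### MP12 Lemma 5.3: `S_A` generates `Λ^⊥(A)` -/

section TrapdoorGen

variable {q : ℕ} {o ι κ : Type*} [Fintype o] [Fintype ι] [Fintype κ] [DecidableEq o] [DecidableEq ι] [DecidableEq κ]

/-- **MP12 Lemma 5.3, generation half (tag `I`).** If `A [R; I] = G`, `G W ≡ −A₁ (mod q)` and the
columns of `S` generate `Λ^⊥(G)`, then every `x ∈ Λ^⊥(A)` is an integer combination of the columns of
`S_A = [[I, R],[0, I]]·[[I, 0],[W, S]]`: with `y₁ = x₁ − R x₂` one has `[A₁ | G](y₁, x₂) ≡ 0`, hence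
`x₂ − W y₁ ∈ Λ^⊥(G) = S ℤ^κ`, say `= S c`, and then `x = S_A (y₁, c)`. [cite: MicciancioPeikert2012, Lemma 5.3] -/
theorem perpLattice_le_span_trapdoorBasisCol {G : Matrix o κ (ZMod q)} {A : Matrix o (ι ⊕ κ) (ZMod q)}
    {R : Matrix ι κ ℤ} (hT : IsGTrapdoor G A R 1) {W : Matrix κ ι ℤ}
    (hW : G * W.map (Int.cast : ℤ → ZMod q) = -A.toCols₁) {S : Matrix κ κ ℤ}
    (hS : perpLattice G ≤ Submodule.span ℤ (Set.range S.col)) :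
    perpLattice A ≤ Submodule.span ℤ (Set.range (trapdoorBasisCol R W S)) := by
  intro x hx
  set x₁ : ι → ℤ := fun i => x (Sum.inl i) with hx₁
  set x₂ : κ → ℤ := fun p => x (Sum.inr p) with hx₂
  set y₁ : ι → ℤ := x₁ - R *ᵥ x₂ with hy₁
  -- the trapdoor identity, blockwise: `A₂ = G − A₁ R`
  have hA : A = Matrix.fromCols A.toCols₁ A.toCols₂ := (fromCols_toCols A).symm
  have hT2 := hT.2
  rw [hA, fromCols_mul_fromRows, Matrix.mul_one, Matrix.one_mul] at hT2
  have hA2 : A.toCols₂ = G - A.toCols₁ * R.map (Int.cast : ℤ → ZMod q) := by rw [← hT2]; abel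
  -- `A x ≡ 0`, blockwise
  have hAx : A.toCols₁ *ᵥ modQ q x₁ + A.toCols₂ *ᵥ modQ q x₂ = 0 := by
    have h := mem_perpLattice.1 hx
    rw [hA, fromCols_mulVec] at h
    exact h
  -- cast bookkeeping: `(M v) mod q = (M mod q) (v mod q)`
  have hmvW : ∀ v : ι → ℤ, modQ q (W *ᵥ v) = W.map (Int.cast : ℤ → ZMod q) *ᵥ modQ q v := fun v => by
    funext i; simp [modQ, mulVec, dotProduct]
  have hmvR : ∀ v : κ → ℤ, modQ q (R *ᵥ v) = R.map (Int.cast : ℤ → ZMod q) *ᵥ modQ q v := fun v => by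
    funext i; simp [modQ, mulVec, dotProduct]
  -- `x₂ − W y₁ ∈ Λ^⊥(G)`
  have hkey : x₂ - W *ᵥ y₁ ∈ perpLattice G := by
    rw [mem_perpLattice, modQ_sub, mulVec_sub, hmvW, mulVec_mulVec, hW, neg_mulVec, sub_neg_eq_add, hy₁,
      modQ_sub, hmvR, mulVec_sub, mulVec_mulVec]
    rw [hA2, sub_mulVec] at hAx
    rw [← hAx]
    abel
  obtain ⟨c, hc⟩ : ∃ c : κ → ℤ, S *ᵥ c = x₂ - W *ᵥ y₁ := by
    have h := hS hkey
    rw [← Matrix.range_mulVecLin] at h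
    exact h
  -- `x = S_A (y₁, c)`
  have hxeq : trapdoorBasisMatrix R W S *ᵥ Sum.elim y₁ c = x := by
    rw [trapdoorBasisMatrix, fromBlocks_mulVec]
    funext r
    rcases r with i | p
    · simp only [Sum.elim_inl, Sum.elim_comp_inl, Sum.elim_comp_inr]
      rw [add_mulVec, one_mulVec, ← mulVec_mulVec, ← mulVec_mulVec, add_assoc, ← mulVec_add, hc, hy₁]
      simp [hx₁]
    · simp only [Sum.elim_inr, Sum.elim_comp_inl, Sum.elim_comp_inr]
      rw [hc]
      simp [hx₂]
  have hmem : x ∈ LinearMap.range (trapdoorBasisMatrix R W S).mulVecLin := ⟨Sum.elim y₁ c, hxeq⟩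
  rw [Matrix.range_mulVecLin] at hmem
  exact hmem

/-- **MP12 Lemma 5.3 (tag `I`): the columns of `S_A` generate exactly `Λ^⊥(A)`** (with the membership
half `trapdoorBasisCol_mem_perpLattice`). [cite: MicciancioPeikert2012, Lemma 5.3] -/
theorem span_trapdoorBasisCol_eq {G : Matrix o κ (ZMod q)} {A : Matrix o (ι ⊕ κ) (ZMod q)}
    {R : Matrix ι κ ℤ} (hT : IsGTrapdoor G A R 1) {W : Matrix κ ι ℤ}
    (hW : G * W.map (Int.cast : ℤ → ZMod q) = -A.toCols₁) {S : Matrix κ κ ℤ}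
    (hS : Submodule.span ℤ (Set.range S.col) = perpLattice G) :
    Submodule.span ℤ (Set.range (trapdoorBasisCol R W S)) = perpLattice A := by
  refine le_antisymm (Submodule.span_le.2 ?_) (perpLattice_le_span_trapdoorBasisCol hT hW hS.ge)
  rintro _ ⟨c, rfl⟩
  refine trapdoorBasisCol_mem_perpLattice hT (by rw [Matrix.one_mul, hW]) (fun c' => ?_) c
  exact hS.le (Submodule.subset_span ⟨c', rfl⟩)

omit [Fintype o] [DecidableEq o] [DecidableEq κ] in
/-- **`S_A` is injective on coefficients** (over a ring where `S` is): `S_A = [[I,R],[0,I]]·[[I,0],[W,S]]`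
with the first factor unimodular and the second block-triangular. [cite: MicciancioPeikert2012, Lemma 5.3 (det S_A = det S)] -/
theorem trapdoorBasisMatrix_map_mulVec_injective {L : Type*} [CommRing L] (R : Matrix ι κ ℤ) (W : Matrix κ ι ℤ)
    (S : Matrix κ κ ℤ) (hS : Function.Injective fun v : κ → L => S.map (Int.cast : ℤ → L) *ᵥ v) :
    Function.Injective fun v : ι ⊕ κ → L => (trapdoorBasisMatrix R W S).map (Int.cast : ℤ → L) *ᵥ v := by
  have e : (Int.cast : ℤ → L) = ⇑(Int.castRingHom L) := rfl
  have hmap : (trapdoorBasisMatrix R W S).map (Int.cast : ℤ → L) =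
      Matrix.fromBlocks (1 + R.map (Int.cast : ℤ → L) * W.map (Int.cast : ℤ → L))
        (R.map (Int.cast : ℤ → L) * S.map (Int.cast : ℤ → L)) (W.map (Int.cast : ℤ → L)) (S.map (Int.cast : ℤ → L)) := by
    rw [trapdoorBasisMatrix, fromBlocks_map, e, Matrix.map_add _ (map_add _), Matrix.map_mul, Matrix.map_mul,
      Matrix.map_one _ (map_zero _) (map_one _)]
  -- kernel is trivial
  suffices hker : ∀ v : ι ⊕ κ → L, (trapdoorBasisMatrix R W S).map (Int.cast : ℤ → L) *ᵥ v = 0 → v = 0 by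
    intro v v' h
    rw [← sub_eq_zero]
    refine hker _ ?_
    rw [mulVec_sub, sub_eq_zero]
    exact h
  intro v hv
  rw [hmap, fromBlocks_mulVec] at hv
  have h2 : W.map (Int.cast : ℤ → L) *ᵥ (v ∘ Sum.inl) + S.map (Int.cast : ℤ → L) *ᵥ (v ∘ Sum.inr) = 0 :=
    funext fun p => congrFun hv (Sum.inr p)
  have h1 : (1 + R.map (Int.cast : ℤ → L) * W.map (Int.cast : ℤ → L)) *ᵥ (v ∘ Sum.inl) +
      (R.map (Int.cast : ℤ → L) * S.map (Int.cast : ℤ → L)) *ᵥ (v ∘ Sum.inr) = 0 :=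
    funext fun i => congrFun hv (Sum.inl i)
  rw [add_mulVec, one_mulVec, ← mulVec_mulVec, ← mulVec_mulVec, add_assoc, ← mulVec_add, h2, mulVec_zero,
    add_zero] at h1
  -- so `v₁ = 0`, then `S v₂ = 0`, so `v₂ = 0`
  have hv1 : v ∘ Sum.inl = 0 := h1
  rw [hv1, mulVec_zero, zero_add] at h2
  have hv2 : v ∘ Sum.inr = 0 := hS (by simp only; rw [h2, mulVec_zero])
  funext r
  rcases r with i | p
  · exact congrFun hv1 i
  · exact congrFun hv2 p

end TrapdoorGen

/-! ### The MP12 trapdoor: `perpBasis` is a basis of `Λ^⊥(A)` -/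

namespace GadgetTrapdoor

variable {n k mbar : ℕ} (T : GadgetTrapdoor n k mbar)

/-- **The explicit basis generates exactly `Λ^⊥(A)`**: `span_ℤ {T.perpBasis c} = Λ^⊥(T.pub)` (MP12
Lemma 5.3 with the power-of-two gadget basis). [cite: MicciancioPeikert2012, Lemma 5.3 with Thm. 4.1] -/
theorem span_perpBasis_eq : Submodule.span ℤ (Set.range T.perpBasis) = perpLattice T.pub := by
  refine span_trapdoorBasisCol_eq T.isGTrapdoor ?_ ?_
  · rw [gadgetMatrix_mul_W, toCols₁_pub]
  · rw [col_gadgetS]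
    exact span_gadgetBasis_eq

/-- Every vector of `Λ^⊥(A)` has integer coordinates in the basis: `x = S_A v`. [cite: MicciancioPeikert2012, Lemma 5.3] -/
theorem exists_perpBasisMatrix_mulVec_eq {x : Fin mbar ⊕ (Fin n × Fin k) → ℤ} (hx : x ∈ perpLattice T.pub) :
    ∃ v : Fin mbar ⊕ (Fin n × Fin k) → ℤ, T.perpBasisMatrix *ᵥ v = x := by
  have h : x ∈ Submodule.span ℤ (Set.range T.perpBasis) := by rw [span_perpBasis_eq]; exact hx
  rw [show T.perpBasis = T.perpBasisMatrix.col from rfl, ← Matrix.range_mulVecLin] at h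
  exact h

/-- **`S_A` is injective on coefficients** over any commutative ring of characteristic zero without zero
divisors. [cite: MicciancioPeikert2012, Lemma 5.3 (det S_A = det S = q^n ≠ 0)] -/
theorem perpBasisMatrix_map_mulVec_injective {L : Type*} [CommRing L] [NoZeroDivisors L] [CharZero L] :
    Function.Injective fun v : Fin mbar ⊕ (Fin n × Fin k) → L => T.perpBasisMatrix.map (Int.cast : ℤ → L) *ᵥ v :=
  trapdoorBasisMatrix_map_mulVec_injective T.R T.W _ gadgetS_map_mulVec_injective

/-- **The basis vectors, read in a characteristic-zero domain `L` (e.g. `ℚ`, `ℝ`), are linearly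
independent.** [cite: MicciancioPeikert2012, Lemma 5.3] -/
theorem linearIndependent_perpBasis_cast {L : Type*} [CommRing L] [NoZeroDivisors L] [CharZero L] :
    LinearIndependent L fun c : Fin mbar ⊕ (Fin n × Fin k) => fun r => ((T.perpBasis c r : ℤ) : L) := by
  have h := Matrix.mulVec_injective_iff.1 (T.perpBasisMatrix_map_mulVec_injective (L := L))
  exact h

/-- In particular the integer basis vectors are linearly independent over `ℤ`. [cite: MicciancioPeikert2012, Lemma 5.3] -/
theorem linearIndependent_perpBasis : LinearIndependent ℤ T.perpBasis := by
  have h := T.linearIndependent_perpBasis_cast (L := ℤ)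
  simp only [Int.cast_id] at h
  exact h

end GadgetTrapdoor

end Literature.Algebra.EuclideanLattices
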